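import Summits.HodgeConjecture.HodgeConjecture.Theorems.MarkmanPartnerTransportPicardThreeK3SquaresSquareOfGenerator
import Summits.HodgeConjecture.HodgeConjecture.Theorems.NikulinTwinTransportSquareGlueFreeNeronSeveri
import Literature.AlgebraicGeometry.Surfaces.K3CorrespondenceComposition
import Literature.AlgebraicGeometry.HodgeTheory.LefschetzOneOneHolds
import Literature.AlgebraicGeometry.HodgeTheory.AlgebraicClassesHodgeTypeHolds

/-!
# Route MarkmanPartnerTransport · crux `PicardThreeK3Squares` (stmt-HodgeConjecture-19652) —
# TRANSPORT OF THE CYCLE-INDUCED SECTOR along a rational Hodge isometry of `H²` (modulo Buskin)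

The crux `PicardThreeK3Squares` (HC⁴ of `S × S` for projective K3 surfaces with `ρ(S) ≥ 3`) is, by the
landed sector files, the real-multiplication problem for K3 squares, and by Varesco's bookkeeping
(`CycleInducedSector` / `SectorIff`) HC⁴(S ⊗ S) is EQUIVALENT to the cycle-induced-sector clause: every
rational Hodge endomorphism `f` of `H²(S(ℂ); ℂ)` killing `N¹(S)` with image in `T(S)` agrees on `T(S)`
with an `N¹`-stable endomorphism `[γ]_*`, `γ` algebraic on `S × S`. This file — route-independent (no
`Theses` import of MarkmanPartnerTransport), so that other K3-square files can build on it — proves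
that THE CLAUSE TRANSPORTS along rational Hodge isometries of `H²`: for projective K3 surfaces `S, S'`
and mutually inverse `ℂ`-linear `φ : H²(S'(ℂ); ℂ) → H²(S(ℂ); ℂ)`, `ψ = φ⁻¹`, each rational, Hodge-type
preserving and isometric for the cup forms read through integral generators `p, p'` of `H⁴` (the
hypotheses of `Buskin2019_hodgeIsometry_algebraic`, for `φ` and for `ψ`), the clause for `S'` implies
the clause for `S`, hence `HodgeConjectureFor 4 (S ⊗ S)` — MODULO the named fact
`Buskin2019_hodgeIsometry_algebraic` (Buskin 2019 Thm. 1.1 / Huybrechts 2019 Thm. 0.2; reduced in the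
tree to three leaves by `BuskinCupLeaf.buskin2019_hodgeIsometry_algebraic_of_three_leaves`). The
companion `…IsogenyInvariance` turns this into «HC⁴(S' ⊗ S') ↔ HC⁴(S ⊗ S) for isogenous K3 surfaces»
and the reduction of the crux to rational Hodge-isometry classes.

Proof (Varesco 2023, §0.2 / §2, the transport behind "X Hodge isometric to a K3 surface with a
symplectic automorphism"): given `f` on `H²(S)`, `f' := ψ ∘ f ∘ φ` qualifies on `S'` (`φ`, `ψ`
exchange `N¹(S')`, `N¹(S)` by Lefschetz `(1,1)`, and exchange their cup-orthogonals by the isometry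
clause), so `f' = [γ']_*` on `T(S')`; then `g := φ ∘ [γ']_* ∘ ψ = [γ_φ]_* ∘ [γ']_* ∘ [γ_ψ]_*` (Buskin for
`φ` AND for `ψ`) is the action of an algebraic class on `S × S` by the composition of algebraic
correspondences between K3 surfaces (`corrComp_K3_of_cup`, Buskin Lemma 6.3 = Fulton Prop. 16.1.1 over
the tree's Gysin base change; its multiplicativity input `N² ∪ N² ⊆ N⁴` is the theorem
`SquareOfGenerator.cupProduct_mem_algebraicClasses_tripleProduct`), `g` is `N¹(S)`-stable and agrees
with `f` on `T(S)`; `CycleInducedSector.hodgeConjectureFor_square_of_cycleInducedSector` concludes.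

* `map_mem_algebraicClasses_one` — a rational, `(1,1)`-type-preserving linear map between the `H²` of
  smooth projective surfaces maps `N¹H²` into `N¹H²` (rational basis of `N¹`,
  `exists_neronSeveri_gramBasis`; algebraic classes are `(1,1)`; Lefschetz `(1,1)`).
* `cycleInducedSector_of_hodgeIsometry` — **the clause for `S'` implies the clause for `S`**, mod Buskin.
* `hodgeConjectureFor_square_of_hodgeIsometry_of_sector` — **the clause for `S'` implies
  `HodgeConjectureFor 4 (S ⊗ S)`**, mod Buskin.

No definition, no sorry; the only named-fact hypothesis is `Buskin2019_hodgeIsometry_algebraic`.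
Prover seat hodge-nonav-19652-p1 (gen 3), `--supports stmt-HodgeConjecture-19652`.

References: Buskin, J. reine angew. Math. 755 (2019), Thm. 1.1, §6.2 Lemma 6.3; Huybrechts, Comment.
Math. Helv. 94 (2019), Thm. 0.2, §1.1; Varesco, Math. Z. 305 (2023) art. 69 = arXiv:2304.02519, §0.2
and §2 (p. 8); Fulton, *Intersection Theory*, §16.1 Prop. 16.1.1; Voisin, *Hodge Theory I*, Thm. 11.30,
Prop. 11.20.
-/

set_option linter.dupNamespace false

noncomputable section

namespace Summit.HodgeConjecture.HodgeConjecture.Theorems.MarkmanPartnerTransport.SectorTransport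

open CategoryTheory MonoidalCategory
open Literature.AlgebraicGeometry Literature.AlgebraicGeometry.Motives Literature.AlgebraicGeometry.HodgeTheory
open Literature.AlgebraicGeometry.Surfaces
open Literature.AlgebraicTopology.SingularHomology
open Summit.HodgeConjecture.HodgeConjecture.Theorems.NikulinTwinTransport
open Summit.HodgeConjecture.HodgeConjecture.Theorems.NikulinTwinTransport.SquareGlueFree

variable {S S' : SchemeOver ℂ}

/-- `Corr[μ, S, S', hS, hS' ; γ, y] = [γ]_* y = fst_* (snd^* y ∪ γ) ∈ H²(S(ℂ); ℂ)` for
`γ ∈ H⁴((S ⊗ S')(ℂ); ℂ)`, `y ∈ H²(S'(ℂ); ℂ)` — LITERALLY the expression in the conclusion of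
`Buskin2019_hodgeIsometry_algebraic` and in `corrComp_K3_of_cup` (for `S' = S` it is the
`Corr[μ, hS ; γ, y]` of `CycleInducedSector` / `SectorIff` at `hS.isSmoothProjective`). Local notation only. -/
local notation3 (prettyPrint := false) "Corr[" μ ", " S ", " S' ", " hS ", " hS' " ; " γ ", " y "]" =>
  complexGysin μ
    (IsSmoothProjective.tensor_holds (IsK3Surface.isSmoothProjective hS)
      (IsK3Surface.isSmoothProjective hS'))
    (IsK3Surface.isSmoothProjective hS) (SemiCartesianMonoidalCategory.fst S S')
    (rfl : 2 * 1 + 2 * 2 + 2 * 2 = 2 * 1 + 2 * (2 + 2))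
    (cupProduct (rfl : 2 * 1 + 2 * 2 = 2 * 1 + 2 * 2)
      (complexBetti.map (SemiCartesianMonoidalCategory.snd S S') (2 * 1) y) γ)

/-! ### `N¹H²` is functorial under rational `(1,1)`-preserving maps -/

/-- **A rational, `(1,1)`-type-preserving linear map `φ : H²(Y) → H²(X)` between smooth projective
surfaces maps `N¹H²(Y) = algebraicClasses Y 1` into `N¹H²(X)`.** `N¹H²(Y)` has a `ℂ`-basis of rational
classes (`exists_neronSeveri_gramBasis`), each of type `(1,1)`
(`isOfHodgeType_of_mem_algebraicClasses_of_isSmoothProjective`); their images are rational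
`(1,1)`-classes, algebraic by Lefschetz `(1,1)` (`lefschetzOneOne_rational_holds`).
[cite: VoisinHodgeI2002, Thm. 11.30 and Prop. 11.20] -/
theorem map_mem_algebraicClasses_one {X Y : SchemeOver ℂ} (hX : IsSmoothProjective 2 X)
    (hY : IsSmoothProjective 2 Y) (φ : complexBetti Y (2 * 1) →ₗ[ℂ] complexBetti X (2 * 1))
    (hrat : ∀ y, IsRationalClass y → IsRationalClass (φ y))
    (htyp : ∀ y, IsOfHodgeType 2 Y (2 * 1) 1 1 y → IsOfHodgeType 2 X (2 * 1) 1 1 (φ y))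
    {d : complexBetti Y (2 * 1)} (hd : d ∈ algebraicClasses Y 1) :
    φ d ∈ algebraicClasses X 1 := by
  obtain ⟨r, b, -, hbQ, hbN, -, hspan, -, -⟩ := exists_neronSeveri_gramBasis hY
  rw [← hspan] at hd
  induction hd using Submodule.span_induction with
  | mem z hz =>
    obtain ⟨i, rfl⟩ := hz
    exact lefschetzOneOne_rational_holds hX _ (hrat _ (hbQ i))
      (htyp _ (isOfHodgeType_of_mem_algebraicClasses_of_isSmoothProjective hY 1 (hbN i)))
  | zero =>
    rw [map_zero]
    exact Submodule.zero_mem _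
  | add z w _ _ hz hw =>
    rw [map_add]
    exact Submodule.add_mem _ hz hw
  | smul a z _ hz =>
    rw [map_smul]
    exact Submodule.smul_mem _ _ hz

/-- An "isometric" map in the sense of `Buskin2019_hodgeIsometry_algebraic`
(`x ∪ y = a p' ⟹ φ x ∪ φ y = a p`) preserves cup-orthogonality. [folklore] -/
theorem cupProduct_eq_zero_of_isometric {p : complexBetti S (2 * 2)} {p' : complexBetti S' (2 * 2)}
    (φ : complexBetti S' (2 * 1) →ₗ[ℂ] complexBetti S (2 * 1))
    (hiso : ∀ (x y : complexBetti S' (2 * 1)) (a : ℂ),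
      cupProduct (rfl : 2 * 1 + 2 * 1 = 2 * 2) x y = a • p' →
        cupProduct (rfl : 2 * 1 + 2 * 1 = 2 * 2) (φ x) (φ y) = a • p)
    {x y : complexBetti S' (2 * 1)} (h : cupProduct (rfl : 2 * 1 + 2 * 1 = 2 * 2) x y = 0) :
    cupProduct (rfl : 2 * 1 + 2 * 1 = 2 * 2) (φ x) (φ y) = 0 := by
  have h0 := hiso x y 0 (by rw [h, zero_smul])
  rwa [zero_smul] at h0

/-! ### The cycle-induced-sector clause transports along a rational Hodge isometry of `H²` -/

/-- **Transport of Varesco's cycle-induced-sector clause along a rational Hodge isometry (mod Buskin's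
Thm. 1.1).** Let `S, S'` be projective K3 surfaces, `p, p'` integral generators of `H⁴(S(ℂ))`,
`H⁴(S'(ℂ))`, and `φ : H²(S'(ℂ); ℂ) → H²(S(ℂ); ℂ)`, `ψ : H²(S(ℂ); ℂ) → H²(S'(ℂ); ℂ)` mutually inverse
`ℂ`-linear maps, each rational, Hodge-type preserving and isometric
(`x ∪ y = a p' ⟹ φ x ∪ φ y = a p`, resp. with `p, p'` exchanged). If every rational Hodge endomorphism of
`H²(S')` killing `N¹(S')` with image `⊥ N¹(S')` agrees on `T(S')` with an `N¹(S')`-stable endomorphism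
induced by an algebraic class on `S' × S'` (at the orientation family `μ`), then the same holds for `S`.
Proof in the module docstring (Buskin for `φ` and `ψ`, composition of algebraic correspondences).
[cite: Buskin2019, Thm. 1.1 and Lemma 6.3] [cite: Varesco2023, §0.2 and §2 (p. 8)]
[cite: Fulton1998, §16.1 Prop. 16.1.1] -/
theorem cycleInducedSector_of_hodgeIsometry (hB : Buskin2019_hodgeIsometry_algebraic)
    (μ : OrientationFamily) (hS : IsK3Surface S) (hS' : IsK3Surface S')
    (p : complexBetti S (2 * 2)) (p' : complexBetti S' (2 * 2))
    (hp : IsIntegralClass p ∧ ∀ q : complexBetti S (2 * 2), IsIntegralClass q → ∃ n : ℤ, q = n • p)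
    (hp' : IsIntegralClass p' ∧ ∀ q : complexBetti S' (2 * 2), IsIntegralClass q → ∃ n : ℤ, q = n • p')
    (φ : complexBetti S' (2 * 1) →ₗ[ℂ] complexBetti S (2 * 1))
    (ψ : complexBetti S (2 * 1) →ₗ[ℂ] complexBetti S' (2 * 1))
    (hφψ : ∀ x, φ (ψ x) = x) (hψφ : ∀ y, ψ (φ y) = y)
    (hφrat : ∀ y, IsRationalClass y → IsRationalClass (φ y))
    (hψrat : ∀ x, IsRationalClass x → IsRationalClass (ψ x))
    (hφtyp : ∀ (i j : ℕ) y, IsOfHodgeType 2 S' (2 * 1) i j y → IsOfHodgeType 2 S (2 * 1) i j (φ y))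
    (hψtyp : ∀ (i j : ℕ) x, IsOfHodgeType 2 S (2 * 1) i j x → IsOfHodgeType 2 S' (2 * 1) i j (ψ x))
    (hφiso : ∀ (x y : complexBetti S' (2 * 1)) (a : ℂ),
      cupProduct (rfl : 2 * 1 + 2 * 1 = 2 * 2) x y = a • p' →
        cupProduct (rfl : 2 * 1 + 2 * 1 = 2 * 2) (φ x) (φ y) = a • p)
    (hψiso : ∀ (x y : complexBetti S (2 * 1)) (a : ℂ),
      cupProduct (rfl : 2 * 1 + 2 * 1 = 2 * 2) x y = a • p →
        cupProduct (rfl : 2 * 1 + 2 * 1 = 2 * 2) (ψ x) (ψ y) = a • p')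
    (hU' : ∀ (f : complexBetti S' (2 * 1) →ₗ[ℂ] complexBetti S' (2 * 1)),
      (∀ y, IsRationalClass y → IsRationalClass (f y)) →
      (∀ (i j : ℕ) y, IsOfHodgeType 2 S' (2 * 1) i j y → IsOfHodgeType 2 S' (2 * 1) i j (f y)) →
      (∀ d ∈ algebraicClasses S' 1, f d = 0) →
      (∀ y : complexBetti S' (2 * 1), ∀ d ∈ algebraicClasses S' 1,
        cupProduct (rfl : 2 * 1 + 2 * 1 = 2 * 2) (f y) d = 0) →
      ∃ g : complexBetti S' (2 * 1) →ₗ[ℂ] complexBetti S' (2 * 1),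
        (∀ d ∈ algebraicClasses S' 1, g d ∈ algebraicClasses S' 1) ∧
        (∃ γ ∈ algebraicClasses (S' ⊗ S') 2, ∀ y : complexBetti S' (2 * 1),
          g y = Corr[μ, S', S', hS', hS' ; γ, y]) ∧
        ∀ y : complexBetti S' (2 * 1),
          (∀ d ∈ algebraicClasses S' 1, cupProduct (rfl : 2 * 1 + 2 * 1 = 2 * 2) y d = 0) →
            f y = g y) :
    ∀ (f : complexBetti S (2 * 1) →ₗ[ℂ] complexBetti S (2 * 1)),
      (∀ y, IsRationalClass y → IsRationalClass (f y)) →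
      (∀ (i j : ℕ) y, IsOfHodgeType 2 S (2 * 1) i j y → IsOfHodgeType 2 S (2 * 1) i j (f y)) →
      (∀ d ∈ algebraicClasses S 1, f d = 0) →
      (∀ y : complexBetti S (2 * 1), ∀ d ∈ algebraicClasses S 1,
        cupProduct (rfl : 2 * 1 + 2 * 1 = 2 * 2) (f y) d = 0) →
      ∃ g : complexBetti S (2 * 1) →ₗ[ℂ] complexBetti S (2 * 1),
        (∀ d ∈ algebraicClasses S 1, g d ∈ algebraicClasses S 1) ∧
        (∃ γ ∈ algebraicClasses (S ⊗ S) 2, ∀ y : complexBetti S (2 * 1),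
          g y = Corr[μ, S, S, hS, hS ; γ, y]) ∧
        ∀ y : complexBetti S (2 * 1),
          (∀ d ∈ algebraicClasses S 1, cupProduct (rfl : 2 * 1 + 2 * 1 = 2 * 2) y d = 0) →
            f y = g y := by
  have hμ : μ.HasPoincareDuality := OrientationFamily.hasPoincareDuality μ
  have hS₁ : IsSmoothProjective 2 S := hS.isSmoothProjective
  have hS'₁ : IsSmoothProjective 2 S' := hS'.isSmoothProjective
  -- `N¹(S') ↦ N¹(S)` under `φ`, `N¹(S) ↦ N¹(S')` under `ψ`
  have hφN : ∀ d ∈ algebraicClasses S' 1, φ d ∈ algebraicClasses S 1 := fun d hd ↦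
    map_mem_algebraicClasses_one hS₁ hS'₁ φ hφrat (hφtyp 1 1) hd
  have hψN : ∀ d ∈ algebraicClasses S 1, ψ d ∈ algebraicClasses S' 1 := fun d hd ↦
    map_mem_algebraicClasses_one hS'₁ hS₁ ψ hψrat (hψtyp 1 1) hd
  -- Buskin for `φ` and for `ψ`
  obtain ⟨γφ, hγφ, hφeq⟩ := hB μ hμ S S' hS hS' p p' hp hp' φ hφrat hφtyp hφiso
  obtain ⟨γψ, hγψ, hψeq⟩ := hB μ hμ S' S hS' hS p' p hp' hp ψ hψrat hψtyp hψiso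
  intro f hfrat hftyp hfN hfT
  -- `f' := ψ ∘ f ∘ φ` qualifies on `S'`
  obtain ⟨g', hg'N, ⟨γ', hγ', hg'eq⟩, hfg'⟩ := hU' (ψ ∘ₗ f ∘ₗ φ)
    (fun y hy ↦ hψrat _ (hfrat _ (hφrat _ hy)))
    (fun i j y hy ↦ hψtyp i j _ (hftyp i j _ (hφtyp i j _ hy)))
    (fun d hd ↦ by rw [LinearMap.comp_apply, LinearMap.comp_apply, hfN _ (hφN d hd), map_zero])
    (fun y d hd ↦ by
      rw [LinearMap.comp_apply, LinearMap.comp_apply, ← hψφ d]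
      exact cupProduct_eq_zero_of_isometric ψ hψiso (hfT _ _ (hφN d hd)))
  -- compose the three correspondences `[γφ] ∘ [γ'] ∘ [γψ]`
  have hCUP := SquareOfGenerator.cupProduct_mem_algebraicClasses_tripleProduct
  obtain ⟨γ₁, hγ₁, hγ₁eq⟩ := corrComp_K3_of_cup μ hCUP S' S' S hS' hS' hS γ' hγ' γψ hγψ
  obtain ⟨γ₂, hγ₂, hγ₂eq⟩ := corrComp_K3_of_cup μ hCUP S S' S hS hS' hS γφ hγφ γ₁ hγ₁
  refine ⟨φ ∘ₗ g' ∘ₗ ψ, fun d hd ↦ ?_, ⟨γ₂, hγ₂, fun y ↦ ?_⟩, fun y hy ↦ ?_⟩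
  · -- `N¹(S)`-stable
    rw [LinearMap.comp_apply, LinearMap.comp_apply]
    exact hφN _ (hg'N _ (hψN d hd))
  · -- induced by the algebraic class `γ₂`
    rw [LinearMap.comp_apply, LinearMap.comp_apply, hφeq, hg'eq, hψeq, ← hγ₁eq, ← hγ₂eq]
  · -- agrees with `f` on `T(S)`
    have hψy : ∀ d ∈ algebraicClasses S' 1,
        cupProduct (rfl : 2 * 1 + 2 * 1 = 2 * 2) (ψ y) d = 0 := fun d hd ↦ by
      rw [← hψφ d]
      exact cupProduct_eq_zero_of_isometric ψ hψiso (hy _ (hφN d hd))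
    have h := hfg' (ψ y) hψy
    rw [LinearMap.comp_apply, LinearMap.comp_apply, hφψ] at h
    rw [LinearMap.comp_apply, LinearMap.comp_apply, ← h, hφψ]

/-- **HC⁴(S ⊗ S) from the cycle-induced-sector clause on an ISOGENOUS K3 surface `S'` (mod Buskin)**:
data as in `cycleInducedSector_of_hodgeIsometry`; conclusion `HodgeConjectureFor 4 (S ⊗ S)` by
`CycleInducedSector.hodgeConjectureFor_square_of_cycleInducedSector`. [cite: Buskin2019, Thm. 1.1]
[cite: Varesco2023, §0.2 and §2 (p. 8)] -/
theorem hodgeConjectureFor_square_of_hodgeIsometry_of_sector (hB : Buskin2019_hodgeIsometry_algebraic)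
    (μ : OrientationFamily) (hS : IsK3Surface S) (hS' : IsK3Surface S')
    (p : complexBetti S (2 * 2)) (p' : complexBetti S' (2 * 2))
    (hp : IsIntegralClass p ∧ ∀ q : complexBetti S (2 * 2), IsIntegralClass q → ∃ n : ℤ, q = n • p)
    (hp' : IsIntegralClass p' ∧ ∀ q : complexBetti S' (2 * 2), IsIntegralClass q → ∃ n : ℤ, q = n • p')
    (φ : complexBetti S' (2 * 1) →ₗ[ℂ] complexBetti S (2 * 1))
    (ψ : complexBetti S (2 * 1) →ₗ[ℂ] complexBetti S' (2 * 1))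
    (hφψ : ∀ x, φ (ψ x) = x) (hψφ : ∀ y, ψ (φ y) = y)
    (hφrat : ∀ y, IsRationalClass y → IsRationalClass (φ y))
    (hψrat : ∀ x, IsRationalClass x → IsRationalClass (ψ x))
    (hφtyp : ∀ (i j : ℕ) y, IsOfHodgeType 2 S' (2 * 1) i j y → IsOfHodgeType 2 S (2 * 1) i j (φ y))
    (hψtyp : ∀ (i j : ℕ) x, IsOfHodgeType 2 S (2 * 1) i j x → IsOfHodgeType 2 S' (2 * 1) i j (ψ x))
    (hφiso : ∀ (x y : complexBetti S' (2 * 1)) (a : ℂ),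
      cupProduct (rfl : 2 * 1 + 2 * 1 = 2 * 2) x y = a • p' →
        cupProduct (rfl : 2 * 1 + 2 * 1 = 2 * 2) (φ x) (φ y) = a • p)
    (hψiso : ∀ (x y : complexBetti S (2 * 1)) (a : ℂ),
      cupProduct (rfl : 2 * 1 + 2 * 1 = 2 * 2) x y = a • p →
        cupProduct (rfl : 2 * 1 + 2 * 1 = 2 * 2) (ψ x) (ψ y) = a • p')
    (hU' : ∀ (f : complexBetti S' (2 * 1) →ₗ[ℂ] complexBetti S' (2 * 1)),
      (∀ y, IsRationalClass y → IsRationalClass (f y)) →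
      (∀ (i j : ℕ) y, IsOfHodgeType 2 S' (2 * 1) i j y → IsOfHodgeType 2 S' (2 * 1) i j (f y)) →
      (∀ d ∈ algebraicClasses S' 1, f d = 0) →
      (∀ y : complexBetti S' (2 * 1), ∀ d ∈ algebraicClasses S' 1,
        cupProduct (rfl : 2 * 1 + 2 * 1 = 2 * 2) (f y) d = 0) →
      ∃ g : complexBetti S' (2 * 1) →ₗ[ℂ] complexBetti S' (2 * 1),
        (∀ d ∈ algebraicClasses S' 1, g d ∈ algebraicClasses S' 1) ∧
        (∃ γ ∈ algebraicClasses (S' ⊗ S') 2, ∀ y : complexBetti S' (2 * 1),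
          g y = Corr[μ, S', S', hS', hS' ; γ, y]) ∧
        ∀ y : complexBetti S' (2 * 1),
          (∀ d ∈ algebraicClasses S' 1, cupProduct (rfl : 2 * 1 + 2 * 1 = 2 * 2) y d = 0) →
            f y = g y) :
    HodgeConjectureFor 4 (S ⊗ S) :=
  CycleInducedSector.hodgeConjectureFor_square_of_cycleInducedSector μ hS.isSmoothProjective
    (cycleInducedSector_of_hodgeIsometry hB μ hS hS' p p' hp hp' φ ψ hφψ hψφ hφrat hψrat hφtyp hψtyp
      hφiso hψiso hU')

end Summit.HodgeConjecture.HodgeConjecture.Theorems.MarkmanPartnerTransport.SectorTransport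

end
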